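import Summits.CriticalPhenomena.CardyFormulaZ2.Theorems.CardyMagicRigidityNestingRigidityTomographyDiscDuality
import HarnessLib

/-!
# The switch-planarity instance `TSwitchPlanar`: reduction to a pure planar statement about two site paths

Crux `Summit.CriticalPhenomena.CardyFormulaZ2.Theses.CardyMagicRigidity.NestingRigidity` (stmt-CriticalPhenomena-4835),
line `pinch-resampling` v4, stub S10' `stub_neckTomographyV4`.  The second planar input of D1 named in
`…NestingRigidityTomographySelection` (p160817), `TSwitchPlanar`, speaks about the GLUED partitions `tGlue` (equivalence
closures of blob steps and passages through other selected regions).  This file performs the first step of its truth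
argument ("realise the open gluing as a `𝕋`-path through open sites off the interiors and through the interiors of
regions `y ≠ x` with `b y = true`, the closed gluing likewise — vertex-disjoint site sets, both avoiding `Λ_{sc x}(x)`")
and thereby REDUCES `TSwitchPlanar` to a statement about ONE clean collar and TWO plain `𝕋`-paths:

* `tRealise ω c β` — the realisation set of colour `c` under the vector `β`: colour-`c` sites off all selected
  interiors, together with the interiors `Λ_{sc y}(y)` of the selected `y` with `β y = c`;
* `eq_or_pathIn_tRealise_of_tGlue` — **glued ⟹ equal or joined by a `𝕋`-path of the realisation set** (blob steps are
  such paths; a passage through `y` is realised through the ball `Λ_{sc y}(y)`, entered and left at the germs, which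
  are inner-layer sites of colour `c` — selected radii are `≥ 2` by `tPinch_one_eq_empty`);
* the realisation sets of (`true`, `update b x false`) and (`false`, `update b x true`) are disjoint, avoid
  `Λ_{sc x}(x)`, and meet `Λ_{2 sc x}(x)` only in open resp. closed sites (`disjoint_tRealise`,
  `disjoint_tRealise_tBall`, `tRealise_inter_tBall_subset`);
* `tSwitchPlanar_of_core` (registered anchor) — **`TSwitchPlanar` follows from its planar core**, displayed as the
  hypothesis (NOT proved here): on `TPinch x x s s`, two open crossings of the collar in distinct open
  collar-clusters and two closed crossings in distinct closed collar-clusters cannot be joined by, respectively, a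
  `𝕋`-path of a set `P` and a `𝕋`-path of a set `Q` with `P ∩ Q = ∅`, both avoiding `Λ_s(x)`, `P` open and `Q`
  closed inside `Λ_{2s}(x)` (Jordan: close the `P`-path through the hole; the closed germs lie on opposite sides by
  the alternation of the four crossing clusters; winding labels, `TriFaceLabel.lean`).

Sorry-free; no `Prop` definition is introduced; the planar core is a displayed hypothesis, not a named fact.
-/

noncomputable section

namespace Summit.CriticalPhenomena.CardyFormulaZ2.Cruxes.NestingRigidity.PinchResampling

open Summit.CriticalPhenomena.CardyFormulaZ2.Theses.CardyMagicRigidity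
open Set Relation Literature.Probability.Percolation Literature.Probability.LatticeModels

variable (sc : Site 2 → ℕ) (X : Set (Site 2))

/-! ## §1 Realisation sets and the realisation of glued pairs as lattice paths -/

section Realise

/-- **The realisation set of colour `c` under `β`**: colour-`c` sites off all selected interiors, and the interiors
of the selected regions whose `β`-state is `c` (the regions through which colour-`c` passages are allowed). -/
def tRealise (ω : SiteConfig (Site 2)) (c : Bool) (β : Site 2 → Bool) : Set (Site 2) :=
  {u | (u ∈ ω) = c ∧ u ∉ tInteriors sc X ω} ∪ ⋃ y ∈ {y | y ∈ tSel sc X ω ∧ β y = c}, tBall y (sc y)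

variable {sc X}

/-- A selected centre has radius `≥ 2` (`TPinch x x 0 0 = TPinch x x 1 1 = ∅`). -/
theorem two_le_of_mem_tSel {ω : SiteConfig (Site 2)} {x : Site 2} (hx : x ∈ tSel sc X ω) : 2 ≤ sc x := by
  have h1 := one_le_of_mem_tSel sc X hx
  by_contra h
  have h1' : sc x = 1 := by omega
  have hm := hx.2
  rw [h1', tPinch_one_eq_empty] at hm
  exact hm

/-- The interior ball `Λ_s(y)` is connected: a translate of `pathIn_triBall`. -/
theorem pathIn_tBall {y u v : Site 2} {s : ℕ} (hu : u ∈ tBall y s) (hv : v ∈ tBall y s) : PathIn triGraph (tBall y s) u v := by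
  simp only [tBall, mem_setOf_eq] at hu hv
  have h := pathIn_triBall (m := s) hu hv
  have := pathIn_shift y (B := tBall y s) (fun z hz ↦ by
    simpa [tBall] using mem_triBall_iff.1 (Finset.mem_coe.1 hz)) h
  simpa using this

/-- **Glued ⟹ equal or joined inside the realisation set.**  With pairwise disjoint closed collars, two sites glued in
colour `c` under `β` are equal or joined by a `𝕋`-path of `tRealise ω c β`. -/
theorem eq_or_pathIn_tRealise_of_tGlue {ω : SiteConfig (Site 2)} {c : Bool} {β : Site 2 → Bool}
    (hdisj : ∀ x ∈ tSel sc X ω, ∀ y ∈ tSel sc X ω, x ≠ y → Disjoint (tBall x (2 * sc x)) (tBall y (2 * sc y)))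
    {v w : Site 2} (h : tGlue sc X ω c β v w) : v = w ∨ PathIn triGraph (tRealise sc X ω c β) v w := by
  rw [tGlue_apply_iff] at h
  induction h with
  | rel v w hr =>
    rcases hr with hp | ⟨y, hy, hb, hv, hw⟩
    · by_cases hvw : v = w
      · exact Or.inl hvw
      · right
        have hcol := colour_of_pathIn_ne hp hvw
        refine (pathIn_inter_of_pathIn_colour hp hcol).mono fun z hz ↦ Or.inl ⟨?_, hz.1⟩
        cases c <;> simpa using hz.2
    · right
      have hs := two_le_of_mem_tSel hy
      obtain ⟨-, hvcol, -⟩ := exists_pathIn_of_isCrossing hs hv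
      obtain ⟨-, hwcol, -⟩ := exists_pathIn_of_isCrossing hs hw
      obtain ⟨⟨hvO, hvI⟩, gv, hgv, hvgv⟩ := hv.1
      obtain ⟨⟨hwO, hwI⟩, gw, hgw, hwgw⟩ := hw.1
      have hballR : tBall y (sc y) ⊆ tRealise sc X ω c β := fun z hz ↦
        Or.inr (mem_biUnion (t := fun y ↦ tBall y (sc y)) ⟨hy, hb⟩ hz)
      have hvR : v ∈ tRealise sc X ω c β := Or.inl ⟨hvcol, not_mem_tInteriors_of_mem_collar hdisj hy hvO hvI⟩
      have hwR : w ∈ tRealise sc X ω c β := Or.inl ⟨hwcol, not_mem_tInteriors_of_mem_collar hdisj hy hwO hwI⟩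
      exact ((PathIn.of_adj hvR (hballR hgv) hvgv).trans ((pathIn_tBall hgv hgw).mono hballR)).trans
        (PathIn.of_adj (hballR hgw) hwR hwgw.symm)
  | refl => exact Or.inl rfl
  | symm _ _ _ ih =>
    rcases ih with e | hp
    · exact Or.inl e.symm
    · exact Or.inr hp.symm
  | trans _ _ _ _ _ ih1 ih2 =>
    rcases ih1 with rfl | hp1
    · exact ih2
    · rcases ih2 with rfl | hp2
      · exact Or.inr hp1
      · exact Or.inr (hp1.trans hp2)

/-- **The two realisation sets of the switch are disjoint**: open vs closed sites off the interiors, and interiors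
of regions `y ≠ x` with `b y = true` vs `b y = false` (distinct selected regions have disjoint closed collars). -/
theorem disjoint_tRealise {ω : SiteConfig (Site 2)}
    (hdisj : ∀ x ∈ tSel sc X ω, ∀ y ∈ tSel sc X ω, x ≠ y → Disjoint (tBall x (2 * sc x)) (tBall y (2 * sc y)))
    (b : Site 2 → Bool) (x : Site 2) :
    Disjoint (tRealise sc X ω true (Function.update b x false)) (tRealise sc X ω false (Function.update b x true)) := by
  rw [Set.disjoint_left]
  rintro u (⟨hu1, hu2⟩ | hu) (⟨hu1', hu2'⟩ | hu')
  · exact absurd (by simpa using hu1 : u ∈ ω) (by simpa using hu1' : u ∉ ω)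
  · simp only [mem_setOf_eq, mem_iUnion, exists_prop] at hu'
    obtain ⟨y, ⟨hy, -⟩, huy⟩ := hu'
    exact hu2 (tBall_subset_tInteriors hy huy)
  · simp only [mem_setOf_eq, mem_iUnion, exists_prop] at hu
    obtain ⟨y, ⟨hy, -⟩, huy⟩ := hu
    exact hu2' (tBall_subset_tInteriors hy huy)
  · simp only [mem_setOf_eq, mem_iUnion, exists_prop] at hu hu'
    obtain ⟨y, ⟨hy, hby⟩, huy⟩ := hu
    obtain ⟨y', ⟨hy', hby'⟩, huy'⟩ := hu'
    have hyy' : y ≠ y' := by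
      rintro rfl
      by_cases hyx : y = x
      · subst hyx; simp at hby
      · rw [Function.update_of_ne hyx] at hby hby'; rw [hby] at hby'; exact Bool.noConfusion hby'
    exact Set.disjoint_left.1 (hdisj y hy y' hy' hyy') (tBall_subset_tBall_two_mul y (sc y) huy)
      (tBall_subset_tBall_two_mul y' (sc y') huy')

/-- **A realisation set under a vector whose `x`-entry is not `c` avoids the interior `Λ_{sc x}(x)`.** -/
theorem disjoint_tRealise_tBall {ω : SiteConfig (Site 2)}
    (hdisj : ∀ x ∈ tSel sc X ω, ∀ y ∈ tSel sc X ω, x ≠ y → Disjoint (tBall x (2 * sc x)) (tBall y (2 * sc y)))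
    {c : Bool} {β : Site 2 → Bool} {x : Site 2} (hx : x ∈ tSel sc X ω) (hβ : β x ≠ c) :
    Disjoint (tRealise sc X ω c β) (tBall x (sc x)) := by
  rw [Set.disjoint_left]
  rintro u (⟨-, hu2⟩ | hu) hux
  · exact hu2 (tBall_subset_tInteriors hx hux)
  · simp only [mem_setOf_eq, mem_iUnion, exists_prop] at hu
    obtain ⟨y, ⟨hy, hby⟩, huy⟩ := hu
    have hyx : y ≠ x := by rintro rfl; exact hβ hby
    exact Set.disjoint_left.1 (hdisj y hy x hx hyx) (tBall_subset_tBall_two_mul y (sc y) huy)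
      (tBall_subset_tBall_two_mul x (sc x) hux)

/-- **Inside the closed collar `Λ_{2 sc x}(x)` a realisation set (vector not `c` at `x`) consists of colour-`c`
sites** (the interiors of the other regions do not meet the closed collar of `x`). -/
theorem tRealise_inter_tBall_subset {ω : SiteConfig (Site 2)}
    (hdisj : ∀ x ∈ tSel sc X ω, ∀ y ∈ tSel sc X ω, x ≠ y → Disjoint (tBall x (2 * sc x)) (tBall y (2 * sc y)))
    {c : Bool} {β : Site 2 → Bool} {x : Site 2} (hx : x ∈ tSel sc X ω) (hβ : β x ≠ c) :
    tRealise sc X ω c β ∩ tBall x (2 * sc x) ⊆ {u | (u ∈ ω) = c} := by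
  rintro u ⟨hu | hu, huO⟩
  · exact hu.1
  · simp only [mem_setOf_eq, mem_iUnion, exists_prop] at hu
    obtain ⟨y, ⟨hy, hby⟩, huy⟩ := hu
    have hyx : y ≠ x := by rintro rfl; exact hβ hby
    exact absurd huO (Set.disjoint_left.1 (hdisj y hy x hx hyx) (tBall_subset_tBall_two_mul y (sc y) huy))

end Realise

/-! ## §2 The planar core (named, not proved) and the reduction -/

section Core

/-- **Registered anchor: the reduction of `TSwitchPlanar` to its planar core.**  The displayed hypothesis is the
PLANAR CORE (the Jordan-curve content of `TSwitchPlanar`, NOT proved here): on the clean collar `TPinch x x s s`, two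
open crossings `v₁, v₂` of `Λ_{2s}(x) ∖ Λ_s(x)` not joined by an open path of the collar and two closed crossings
`w₁, w₂` not joined by a closed path of the collar admit no sets of sites `P, Q` with `P ∩ Q = ∅`, both avoiding the
hole `Λ_s(x)`, `P` open and `Q` closed inside `Λ_{2s}(x)`, with `v₁ ⇝ v₂` inside `P` and `w₁ ⇝ w₂` inside `Q` by
`𝕋`-paths.  (WHY TRUE: close the `P`-path through `Λ_s(x)` into a lattice loop `J`; by the alternation of the four
crossing clusters — frontier chains, `exists_frontierChains_alternating_of_lt` — and since `P` is open inside the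
closed collar, `w₁`, `w₂` lie on opposite sides of `J`, winding labels `IsTriLoop.faceLabel_leftFace/rightFace` of
`TriFaceLabel.lean`, while the `Q`-path joins them off `J`, `cellLabel_eq_of_pathIn`.)  THE REDUCTION: realise the open
gluing under `update b x false` inside `P = tRealise ω true (update b x false)` and the closed gluing under
`update b x true` inside `Q = tRealise ω false (update b x true)`; these sets are disjoint, avoid `Λ_{sc x}(x)`, and are
open resp. closed inside `Λ_{2 sc x}(x)`; germs in distinct collar-clusters are distinct, so both gluings are paths. -/
theorem tSwitchPlanar_of_core :
    (∀ (ω : SiteConfig (Site 2)) (x : Site 2) (s : ℕ) (P Q : Set (Site 2)) (v₁ v₂ w₁ w₂ : Site 2),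
      ω ∈ TPinch x x s s → Disjoint P Q → Disjoint P (tBall x s) → Disjoint Q (tBall x s) →
      P ∩ tBall x (2 * s) ⊆ {u | (u ∈ ω) = true} → Q ∩ tBall x (2 * s) ⊆ {u | (u ∈ ω) = false} →
      IsCrossing triGraph (tColourGraph ω true) (tBall x s) (tBall x (2 * s)) v₁ →
      IsCrossing triGraph (tColourGraph ω true) (tBall x s) (tBall x (2 * s)) v₂ →
      ¬ PathIn (tColourGraph ω true) (tBall x (2 * s) \ tBall x s) v₁ v₂ →
      IsCrossing triGraph (tColourGraph ω false) (tBall x s) (tBall x (2 * s)) w₁ →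
      IsCrossing triGraph (tColourGraph ω false) (tBall x s) (tBall x (2 * s)) w₂ →
      ¬ PathIn (tColourGraph ω false) (tBall x (2 * s) \ tBall x s) w₁ w₂ →
      PathIn triGraph P v₁ v₂ → PathIn triGraph Q w₁ w₂ → False) →
    TSwitchPlanar := by
  intro hcore sc X ω b x v₁ v₂ w₁ w₂ hdisj hx hv₁ hv₂ hnv hw₁ hw₂ hnw ⟨hgo, hgc⟩
  have hβ₁ : Function.update b x false x ≠ true := by simp
  have hβ₂ : Function.update b x true x ≠ false := by simp
  have hv₁₂ : v₁ ≠ v₂ := by rintro rfl; exact hnv (PathIn.refl hv₁.1.1)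
  have hw₁₂ : w₁ ≠ w₂ := by rintro rfl; exact hnw (PathIn.refl hw₁.1.1)
  have hP := (eq_or_pathIn_tRealise_of_tGlue hdisj hgo).resolve_left hv₁₂
  have hQ := (eq_or_pathIn_tRealise_of_tGlue hdisj hgc).resolve_left hw₁₂
  exact hcore ω x (sc x) _ _ v₁ v₂ w₁ w₂ hx.2 (disjoint_tRealise hdisj b x) (disjoint_tRealise_tBall hdisj hx hβ₁)
    (disjoint_tRealise_tBall hdisj hx hβ₂) (tRealise_inter_tBall_subset hdisj hx hβ₁)
    (tRealise_inter_tBall_subset hdisj hx hβ₂) hv₁ hv₂ hnv hw₁ hw₂ hnw hP hQ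

end Core

end Summit.CriticalPhenomena.CardyFormulaZ2.Cruxes.NestingRigidity.PinchResampling

end
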